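import Mathlib.Analysis.SpecialFunctions.Pow.Deriv
import Mathlib.Analysis.Calculus.IteratedDeriv.Lemmas
import Mathlib.Analysis.Calculus.ContDiff.Polynomial
import Mathlib.FieldTheory.Separable
import Mathlib.Order.Interval.Set.Infinite
import Summits.Parity.BatemanHorn.Theorems.SoloInformedRootConvexity
import Literature.NumberTheory.DiophantineGeometry.InterpolationDeterminant

/-!
# Higher derivatives of `φ = G^{1/k}` for a real polynomial `G`

SOLOIST deliverable (unit `solo-Parity-informed`, session 15), third part of the elementary treatment of
`k`-th power values of an integer polynomial (the divided-difference argument of Jarník and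
Bombieri–Pila in its crudest form).  For `G ∈ ℝ[X]` and an exponent `c` we define polynomials
`H_j = rootIterPoly G c j` by `H_0 = 1`, `H_{j+1} = (c - j) G' H_j + G H_j'`, so that on any ray where
`G > 0` the `j`-th derivative of `φ(t) = G(t)^c` is `Φ_j(t) = G(t)^{c-j} H_j(t)`
(`iteratedDeriv_polyRootFun_eq`).  Consequences:

* `natDegree_rootIterPoly_le`: `deg H_j ≤ j (deg G - 1)`;
* `exists_rootIterFun_bounds`: if `H_s ≠ 0`, `c = 1/k`, `k ≥ 2`, `s ≥ 1`, then for large `t`,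
  `Φ_s(t) ≠ 0` and `|Φ_s(t)| ≤ M t^{deg G / k - s}`;
* `rootIterPoly_ne_zero`: **non-degeneracy** — if `G` is separable of degree `≥ 1` with positive leading
  coefficient and `k ≥ 2` then `H_s ≠ 0` for every `s`.  Proof: were `H_s = 0`, the `s`-th derivative of
  `φ` would vanish on a ray, so every `s`-th divided difference of `φ` vanishes there (mean value theorem
  for divided differences, `Literature…InterpolationDeterminant.exists_newtonCoeff_eq`), so `φ` agrees
  with one interpolation polynomial `p` on a ray, so `G = p^k` as polynomials — impossible for `G`
  separable and `k ≥ 2`.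
-/

namespace Summit.Parity.BatemanHorn.Theorems

open Polynomial Filter Set
open scoped Topology Nat
open Literature.NumberTheory.DiophantineGeometry.Dioph

/-! ### The polynomials `H_j` and the functions `Φ_j = G^{c-j} H_j` -/

/-- The polynomials `H_j`: `H_0 = 1`, `H_{j+1} = (c - j) G' H_j + G H_j'`. -/
noncomputable def rootIterPoly (G : ℝ[X]) (c : ℝ) : ℕ → ℝ[X]
  | 0 => 1
  | j + 1 => C (c - j) * derivative G * rootIterPoly G c j + G * derivative (rootIterPoly G c j)

/-- `H_0 = 1`. -/
@[simp] theorem rootIterPoly_zero (G : ℝ[X]) (c : ℝ) : rootIterPoly G c 0 = 1 := rfl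

/-- The recursion for `H_{j+1}`. -/
theorem rootIterPoly_succ (G : ℝ[X]) (c : ℝ) (j : ℕ) :
    rootIterPoly G c (j + 1)
      = C (c - j) * derivative G * rootIterPoly G c j + G * derivative (rootIterPoly G c j) := rfl

/-- `Φ_j(t) = G(t)^{c - j} H_j(t)`. -/
noncomputable def rootIterFun (G : ℝ[X]) (c : ℝ) (j : ℕ) (t : ℝ) : ℝ :=
  (G.eval t) ^ (c - j) * (rootIterPoly G c j).eval t

/-- `Φ_0 = φ = G^c`. -/
theorem rootIterFun_zero (G : ℝ[X]) (c t : ℝ) : rootIterFun G c 0 t = polyRootFun G c t := by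
  simp [rootIterFun, polyRootFun]

/-- `Φ_j' = Φ_{j+1}` where `G > 0`. -/
theorem hasDerivAt_rootIterFun (G : ℝ[X]) (c : ℝ) (j : ℕ) {t : ℝ} (ht : 0 < G.eval t) :
    HasDerivAt (rootIterFun G c j) (rootIterFun G c (j + 1) t) t := by
  have h1 : HasDerivAt (fun t => (G.eval t) ^ (c - j))
      ((derivative G).eval t * (c - j) * (G.eval t) ^ (c - j - 1)) t :=
    (G.hasDerivAt t).rpow_const (Or.inl ht.ne')
  have h2 : HasDerivAt (fun t => (rootIterPoly G c j).eval t)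
      ((derivative (rootIterPoly G c j)).eval t) t := (rootIterPoly G c j).hasDerivAt t
  have e1 : (G.eval t) ^ (c - (j : ℝ) - 1) = (G.eval t) ^ (c - ((j : ℝ) + 1)) := by
    congr 1; ring
  have e2 : (G.eval t) ^ (c - (j : ℝ)) = (G.eval t) ^ (c - ((j : ℝ) + 1)) * G.eval t := by
    rw [← Real.rpow_add_one ht.ne']; congr 1; ring
  have key : rootIterFun G c (j + 1) t
      = (derivative G).eval t * (c - j) * (G.eval t) ^ (c - j - 1) * (rootIterPoly G c j).eval t
        + (G.eval t) ^ (c - j) * (derivative (rootIterPoly G c j)).eval t := by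
    unfold rootIterFun
    rw [rootIterPoly_succ, Nat.cast_succ]
    simp only [eval_add, eval_mul, eval_C]
    rw [e1, e2]
    ring
  have h : HasDerivAt (rootIterFun G c j)
      ((derivative G).eval t * (c - j) * (G.eval t) ^ (c - j - 1) * (rootIterPoly G c j).eval t
        + (G.eval t) ^ (c - j) * (derivative (rootIterPoly G c j)).eval t) t := h1.mul h2
  rw [← key] at h
  exact h

/-- `deg H_j ≤ j (deg G - 1)`. -/
theorem natDegree_rootIterPoly_le (G : ℝ[X]) (c : ℝ) (j : ℕ) :
    (rootIterPoly G c j).natDegree ≤ j * (G.natDegree - 1) := by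
  induction j with
  | zero => simp
  | succ j ih =>
    rw [rootIterPoly_succ]
    set H := rootIterPoly G c j with hH
    have hG' : (derivative G).natDegree ≤ G.natDegree - 1 := natDegree_derivative_le G
    refine (natDegree_add_le _ _).trans (max_le ?_ ?_)
    · calc (C (c - j) * derivative G * H).natDegree
          ≤ (C (c - (j : ℝ)) * derivative G).natDegree + H.natDegree := natDegree_mul_le
        _ ≤ (derivative G).natDegree + H.natDegree := by
            gcongr; exact natDegree_C_mul_le _ _
        _ ≤ (G.natDegree - 1) + j * (G.natDegree - 1) := add_le_add hG' ih
        _ = (j + 1) * (G.natDegree - 1) := by ring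
    · by_cases hH' : derivative H = 0
      · rw [hH', mul_zero, natDegree_zero]; exact Nat.zero_le _
      have hH1 : 1 ≤ H.natDegree := by
        by_contra h0
        exact hH' (derivative_of_natDegree_zero (by omega))
      have hdH : (derivative H).natDegree ≤ H.natDegree - 1 := natDegree_derivative_le H
      calc (G * derivative H).natDegree ≤ G.natDegree + (derivative H).natDegree := natDegree_mul_le
        _ ≤ G.natDegree + (j * (G.natDegree - 1) - 1) := by gcongr; omega
        _ ≤ (j + 1) * (G.natDegree - 1) := by
            rw [add_mul, one_mul]
            generalize hP : j * (G.natDegree - 1) = P at *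
            omega

/-! ### Identification with the iterated derivatives of `φ = G^c`, smoothness -/

/-- On a ray where `G > 0`, `φ^{(j)} = Φ_j`. -/
theorem iteratedDeriv_polyRootFun_eq (G : ℝ[X]) (c : ℝ) {T : ℝ} (hG : ∀ t, T < t → 0 < G.eval t) :
    ∀ j : ℕ, ∀ t : ℝ, T < t → iteratedDeriv j (polyRootFun G c) t = rootIterFun G c j t := by
  intro j
  induction j with
  | zero => intro t _; rw [iteratedDeriv_zero, rootIterFun_zero]
  | succ j ih =>
    intro t ht
    rw [iteratedDeriv_succ]
    have hev : iteratedDeriv j (polyRootFun G c) =ᶠ[𝓝 t] rootIterFun G c j :=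
      Filter.eventually_of_mem (Ioi_mem_nhds ht) fun u hu => ih u hu
    rw [hev.deriv_eq]
    exact (hasDerivAt_rootIterFun G c j (hG t ht)).deriv

/-- `φ = G^c` is smooth on a ray where `G > 0`. -/
theorem contDiffOn_polyRootFun (G : ℝ[X]) (c : ℝ) {T : ℝ} (hG : ∀ t, T < t → 0 < G.eval t) (n : ℕ) :
    ContDiffOn ℝ n (polyRootFun G c) (Set.Ioi T) := by
  intro t ht
  have h1 : ContDiffAt ℝ n (fun u => G.eval u) t := by
    have h := (Polynomial.contDiff_aeval (𝕜 := ℝ) G n).contDiffAt (x := t)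
    simpa only [Polynomial.coe_aeval_eq_eval] using h
  exact (h1.rpow_const_of_ne (p := c) (hG t ht).ne').contDiffWithinAt

/-- A polynomial with positive leading coefficient is positive on a ray. -/
theorem exists_forall_gt_eval_pos (G : ℝ[X]) (hlc : 0 < G.leadingCoeff) :
    ∃ T : ℝ, ∀ t, T < t → 0 < G.eval t := by
  obtain ⟨T, hT⟩ := eventually_atTop.mp
    ((eventually_lead_div_two_le_eval G hlc).and (eventually_gt_atTop (0 : ℝ)))
  refine ⟨T, fun t ht => ?_⟩
  obtain ⟨⟨h1, -⟩, h0⟩ := hT t ht.le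
  exact lt_of_lt_of_le (by positivity) h1

/-! ### Size of `Φ_s` for large `t` -/

/-- **Bounds for `φ^{(s)}`.**  If `H_s ≠ 0` (`c = 1/k`, `k ≥ 2`, `s ≥ 1`, `deg G ≥ 1`, positive leading
coefficient), there are `T₁ ≥ 1`, `M > 0` with `G(t) > 0`, `Φ_s(t) ≠ 0` and `|Φ_s(t)| ≤ M t^{deg G/k - s}`
for `t ≥ T₁`. -/
theorem exists_rootIterFun_bounds (G : ℝ[X]) {k : ℕ} (hk : 2 ≤ k) (hd : 1 ≤ G.natDegree)
    (hlc : 0 < G.leadingCoeff) {s : ℕ} (hs : 1 ≤ s) (hH : rootIterPoly G (k : ℝ)⁻¹ s ≠ 0) :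
    ∃ T₁ M : ℝ, 1 ≤ T₁ ∧ 0 < M ∧ ∀ t : ℝ, T₁ ≤ t →
      0 < G.eval t ∧ rootIterFun G (k : ℝ)⁻¹ s t ≠ 0
        ∧ |rootIterFun G (k : ℝ)⁻¹ s t| ≤ M * t ^ ((G.natDegree : ℝ) / k - s) := by
  set d := G.natDegree with hd'
  set a := G.leadingCoeff with ha
  set H := rootIterPoly G (k : ℝ)⁻¹ s with hHdef
  have hHlc : H.leadingCoeff ≠ 0 := leadingCoeff_ne_zero.mpr hH
  -- sign-normalise `H`
  obtain ⟨P, hPlc, hPdeg, hPabs⟩ : ∃ P : ℝ[X], 0 < P.leadingCoeff ∧ P.natDegree = H.natDegree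
      ∧ ∀ t, |H.eval t| = |P.eval t| := by
    rcases lt_or_gt_of_ne hHlc with hneg | hpos
    · exact ⟨-H, by rw [leadingCoeff_neg]; linarith, natDegree_neg H,
        fun t => by rw [eval_neg, abs_neg]⟩
    · exact ⟨H, hpos, rfl, fun _ => rfl⟩
  have hPdeg' : P.natDegree ≤ s * (d - 1) := hPdeg ▸ natDegree_rootIterPoly_le G _ s
  have hk1 : (1 : ℝ) ≤ k := by exact_mod_cast (show 1 ≤ k by omega)
  have hk0 : (0 : ℝ) < k := by linarith
  set e : ℝ := (k : ℝ)⁻¹ - s with he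
  have he0 : e ≤ 0 := by
    have h1 : (k : ℝ)⁻¹ ≤ 1 := inv_le_one_of_one_le₀ hk1
    have h2 : (1 : ℝ) ≤ s := by exact_mod_cast hs
    rw [he]; linarith
  obtain ⟨T₁, hT₁⟩ := eventually_atTop.mp ((eventually_lead_div_two_le_eval G hlc).and
    ((eventually_lead_div_two_le_eval P hPlc).and (eventually_ge_atTop (1 : ℝ))))
  set M : ℝ := (a / 2) ^ e * (2 * P.leadingCoeff) with hM
  have hM0 : 0 < M := by
    rw [hM]
    have : 0 < (a / 2) ^ e := Real.rpow_pos_of_pos (by positivity) e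
    positivity
  refine ⟨max T₁ 1, M, le_max_right _ _, hM0, fun t ht => ?_⟩
  obtain ⟨⟨hG1, -⟩, ⟨hP1, hP2⟩, ht1⟩ := hT₁ t ((le_max_left _ _).trans ht)
  have ht0 : 0 < t := by linarith
  have hGpos : 0 < G.eval t := lt_of_lt_of_le (by positivity) hG1
  have hPpos : 0 < P.eval t := lt_of_lt_of_le (by positivity) hP1
  have hHabs : |H.eval t| = P.eval t := by rw [hPabs, abs_of_pos hPpos]
  have hGe0 : 0 < (G.eval t) ^ e := Real.rpow_pos_of_pos hGpos e
  refine ⟨hGpos, ?_, ?_⟩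
  · unfold rootIterFun
    rw [← hHdef, ← he]
    refine mul_ne_zero hGe0.ne' fun h0 => ?_
    rw [h0, abs_zero] at hHabs
    linarith
  · unfold rootIterFun
    rw [← hHdef, ← he, abs_mul, abs_of_pos hGe0, hHabs]
    rw [← ha] at hG1
    have hGe : (G.eval t) ^ e ≤ (a / 2) ^ e * t ^ ((d : ℝ) * e) := by
      calc (G.eval t) ^ e ≤ (a / 2 * t ^ d) ^ e := Real.rpow_le_rpow_of_nonpos (by positivity) hG1 he0
        _ = (a / 2) ^ e * (t ^ d) ^ e := Real.mul_rpow (by positivity) (by positivity)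
        _ = (a / 2) ^ e * t ^ ((d : ℝ) * e) := by rw [Real.rpow_natCast_mul ht0.le]
    have hPe : P.eval t ≤ 2 * P.leadingCoeff * t ^ (s * (d - 1)) :=
      hP2.trans (mul_le_mul_of_nonneg_left (pow_le_pow_right₀ ht1 hPdeg') (by positivity))
    have hexp : t ^ ((d : ℝ) * e) * t ^ (s * (d - 1)) = t ^ ((d : ℝ) / k - s) := by
      rw [← Real.rpow_natCast t (s * (d - 1)), ← Real.rpow_add ht0]
      congr 1
      rw [Nat.cast_mul, Nat.cast_sub hd, he]
      push_cast
      field_simp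
      ring
    calc (G.eval t) ^ e * P.eval t
        ≤ ((a / 2) ^ e * t ^ ((d : ℝ) * e)) * (2 * P.leadingCoeff * t ^ (s * (d - 1))) :=
          mul_le_mul hGe hPe hPpos.le (by positivity)
      _ = M * (t ^ ((d : ℝ) * e) * t ^ (s * (d - 1))) := by rw [hM]; ring
      _ = M * t ^ ((d : ℝ) / k - s) := by rw [hexp]

/-! ### Non-degeneracy: `H_s ≠ 0` for separable `G` -/

/-- Lagrange interpolation only depends on the nodes and values on the index set. -/
theorem interpolate_congr {ι : Type*} [DecidableEq ι] {s : Finset ι} {v v' r r' : ι → ℝ}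
    (hv : ∀ i ∈ s, v i = v' i) (hr : ∀ i ∈ s, r i = r' i) :
    Lagrange.interpolate s v r = Lagrange.interpolate s v' r' := by
  rw [Lagrange.interpolate_apply, Lagrange.interpolate_apply]
  refine Finset.sum_congr rfl fun i hi => ?_
  rw [hr i hi]
  congr 1
  unfold Lagrange.basis
  refine Finset.prod_congr rfl fun j hj => ?_
  rw [hv i hi, hv j (Finset.mem_of_mem_erase hj)]

/-- **Non-degeneracy.**  For `G ∈ ℝ[X]` separable, of degree `≥ 1`, with positive leading coefficient, and
`k ≥ 2`: `H_s ≠ 0` for every `s` (with `c = 1/k`), i.e. no derivative of `G^{1/k}` vanishes identically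
on a ray. -/
theorem rootIterPoly_ne_zero (G : ℝ[X]) {k : ℕ} (hk : 2 ≤ k) (hd : 1 ≤ G.natDegree)
    (hlc : 0 < G.leadingCoeff) (hsep : G.Separable) (s : ℕ) : rootIterPoly G (k : ℝ)⁻¹ s ≠ 0 := by
  intro hH
  obtain ⟨T, hGpos⟩ := exists_forall_gt_eval_pos G hlc
  have hφs : ∀ t, T < t → iteratedDeriv s (polyRootFun G (k : ℝ)⁻¹) t = 0 := fun t ht => by
    rw [iteratedDeriv_polyRootFun_eq G _ hGpos s t ht, rootIterFun, hH, eval_zero, mul_zero]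
  cases s with
  | zero => simp at hH
  | succ s' =>
  -- nodes: `T+1, …, T+1+s'` fixed, the last one `t` free
  let x : ℝ → ℕ → ℝ := fun t i => if i ≤ s' then T + 1 + i else t + ((i - (s' + 1) : ℕ) : ℝ)
  have hx_lo : ∀ t : ℝ, ∀ i : ℕ, i ≤ s' → x t i = T + 1 + i := fun t i hi => by
    simp only [x, if_pos hi]
  have hx_hi : ∀ t : ℝ, ∀ i : ℕ, s' < i → x t i = t + ((i - (s' + 1) : ℕ) : ℝ) := fun t i hi => by
    simp only [x, if_neg (not_le.mpr hi)]
  have hx_last : ∀ t : ℝ, x t (s' + 1) = t := fun t => by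
    rw [hx_hi t (s' + 1) (Nat.lt_succ_self _), Nat.sub_self, Nat.cast_zero, add_zero]
  have hxmono : ∀ t : ℝ, T + 1 + s' < t → StrictMono (x t) := by
    intro t ht
    refine strictMono_nat_of_lt_succ fun n => ?_
    rcases lt_trichotomy (n + 1) (s' + 1) with h | h | h
    · rw [hx_lo t n (by omega), hx_lo t (n + 1) (by omega)]; push_cast; linarith
    · have hn : n = s' := by omega
      subst hn
      rw [hx_lo t n le_rfl, hx_last]; exact ht
    · rw [hx_hi t n (by omega), hx_hi t (n + 1) (by omega)]
      have : ((n - (s' + 1) : ℕ) : ℝ) < ((n + 1 - (s' + 1) : ℕ) : ℝ) := by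
        exact_mod_cast (show n - (s' + 1) < n + 1 - (s' + 1) by omega)
      linarith
  set t₀ : ℝ := T + 1 + s' + 1 with ht₀
  set p : ℝ[X] := interpAt (x t₀) (polyRootFun G (k : ℝ)⁻¹) s' with hp
  have hinterp : ∀ t : ℝ, interpAt (x t) (polyRootFun G (k : ℝ)⁻¹) s' = p := by
    intro t
    rw [hp]
    unfold interpAt
    refine interpolate_congr (fun i hi => ?_) (fun i hi => ?_)
    · rw [hx_lo t i (by simpa [Nat.lt_succ_iff] using hi), hx_lo t₀ i (by simpa [Nat.lt_succ_iff] using hi)]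
    · rw [hx_lo t i (by simpa [Nat.lt_succ_iff] using hi), hx_lo t₀ i (by simpa [Nat.lt_succ_iff] using hi)]
  -- `φ = p` on the ray `(T + 1 + s', ∞)`
  have hφp : ∀ t : ℝ, T + 1 + s' < t → polyRootFun G (k : ℝ)⁻¹ t = p.eval t := by
    intro t ht
    have hsub : Set.Icc (x t 0) (x t (s' + 1)) ⊆ Set.Ioi T := fun u hu =>
      lt_of_lt_of_le (by rw [hx_lo t 0 (Nat.zero_le _)]; push_cast; linarith) hu.1
    obtain ⟨ξ, hξ, hξeq⟩ := exists_newtonCoeff_eq (polyRootFun G (k : ℝ)⁻¹) (hxmono t ht)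
      isOpen_Ioi (s' + 1) (contDiffOn_polyRootFun G _ hGpos (s' + 1)) hsub
    rw [hφs ξ (hsub hξ)] at hξeq
    have hN : newtonCoeff (x t) (polyRootFun G (k : ℝ)⁻¹) (s' + 1) = 0 := by
      have hf : (((s' + 1).factorial : ℕ) : ℝ) ≠ 0 := by positivity
      rcases mul_eq_zero.mp hξeq.symm with h | h
      · exact absurd h hf
      · exact h
    have h1 := interpAt_succ (polyRootFun G (k : ℝ)⁻¹) (hxmono t ht) s'
    rw [hN, map_zero, zero_mul, add_zero, hinterp t] at h1
    have h2 := eval_interpAt (polyRootFun G (k : ℝ)⁻¹) (hxmono t ht) (k := s' + 1) (i := s' + 1) le_rfl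
    rw [h1, hx_last] at h2
    exact h2.symm
  -- hence `G = p ^ k` as polynomials
  have hGp : G = p ^ k := by
    apply Polynomial.eq_of_infinite_eval_eq
    refine Set.Infinite.mono (s := Set.Ioi (T + 1 + s')) (fun t ht => ?_) (Set.Ioi_infinite _)
    simp only [Set.mem_setOf_eq, eval_pow]
    rw [← hφp t ht]
    unfold polyRootFun
    exact (Real.rpow_inv_natCast_pow (hGpos t (by simp only [Set.mem_Ioi] at ht; linarith)).le
      (by omega)).symm
  -- contradiction with separability
  have hp_dvd : p ∣ G := by
    rw [hGp]; exact dvd_pow_self p (by omega)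
  have hp_dvd' : p ∣ derivative G := by
    rw [hGp, derivative_pow]
    exact Dvd.dvd.mul_right (Dvd.dvd.mul_left (dvd_pow_self p (by omega)) _) _
  have hcop : IsCoprime G (derivative G) := hsep
  have hunit : IsUnit p := hcop.isUnit_of_dvd' hp_dvd hp_dvd'
  have hp0 : p.natDegree = 0 := natDegree_eq_zero_of_isUnit hunit
  have : G.natDegree = 0 := by rw [hGp, natDegree_pow, hp0, mul_zero]
  omega

end Summit.Parity.BatemanHorn.Theorems
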